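import Summits.BirchSwinnertonDyer.Rank1Residual.X12.O11.RouteUJacobiPsi
import HarnessLib

/-!
# ROUTE U, generic member — the ψ-layer `ψ = χ·ω²` at level `7n` and the Bernoulli characters
# `θ₁ = χ↑·ω⁴↑`, `θ₂ = χ↑·κ↑·ω↑`, for a PRIMITIVE ODD quadratic character `χ` mod `n` given by an
# INTEGER VALUE FUNCTION `v` (`χ(a) = v(a)`, `v(a) ∈ {0, ±1}`)

bsd-cm cell (run/shared/lean/pub/bsd-cm/), ROUTE U (Theorem U: BSD(49a1^{(D)}, 7)), seat `bsd-cm-ram`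
(g6). `RouteUPrimePsi` (prime `q`, Legendre values) and `RouteUJacobiPsi` (odd `m`, Jacobi values
`J(· | m)`) did this layer for the ODD members `D = −m`. The EVEN members `D = −4n`
(`n ≡ 1, 2 (mod 4)` squarefree: `−4, −8, −20, −24, −40, −52, −68, −88` in the O11 window at `7`) have
Kronecker character `χ_D` of EVEN conductor `4n` with values `χ_D(a) = (−n / a)` (Kronecker symbol;
`0` at even `a`), which is not of the form `J(a | ·)`. This file therefore redoes the layer ONCE for
an arbitrary level `n` coprime to `7` and a character `χ` mod `n` that is ASSUMED primitive and odd,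
with values given by any integer function `v : ℕ → ℤ` taking values in `{0, 1, −1}`
(`hχ : χ(a) = v(a)`); both earlier layers are the instances `v = (·/q)`, `v = J(· | m)`, and the even
layer is `v(a) = [a odd]·J(−n | a)`. Given `ω` mod `7` Teichmüller, `κ` mod `r` with values `w`:

* `quadVal_eq_zero` / `quadVal_sq_eq_one` / `quadVal_val_zmod` — `v` vanishes off the units, squares to
  `1` on the units, and is read through `ZMod (7n)`;
* `psiK_apply` (`ψ(j) = v(j)·ω(j)²`), `psiK_odd` (from `χ` odd), `psiK_traceIdentity`
  (`ψ(ℓ) + ψ⁻¹(ℓ)ω(ℓ) = v(ℓ)(ω(ℓ)² + ω(ℓ)⁵)` for `ℓ` coprime to `7n`), `psiK_inv_apply`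
  (`ψ⁻¹(j) = v(j)ω(j)⁴`), `thetaOneK_apply`, `thetaOneK_eq_psiK_inv`;
* `bernoulliCharOne_psiK` (`= (ψ⁻¹)↑`), `bernoulliCharTwo_psiK` (`= θ₂↑`), `thetaTwoK_apply`
  (`θ₂(j) = v(j)·w(j)·ω(j)`).
Primitivity statements do not depend on the values and are REUSED from `RouteUJacobiPsi`
(`psiJ_isPrimitive`, `psiJ_inv_isPrimitive`, `primVal_invMulOmega_psiJ_ne_one`,
`psiJ_apply_natCast_ne_one_of_not_coprime`, `thetaTwoJ_isPrimitive`).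

THEOREMS ONLY; no definitions, no named facts; nothing booked. References: [KrizLi2019] Thm. 1.20,
§1.5, §2; [Washington1997] Ch. 3, §5.1; [Cox2013] §1.C Lemma 1.14.
-/

noncomputable section

open scoped Classical
open DirichletCharacter Literature.NumberTheory.EllipticCurves.KrizLi2019 Literature.NumberTheory.LFunctions

namespace Summit.BirchSwinnertonDyer.Rank1Residual.X12.O11.RouteU

/-! ## §1 The value function of a quadratic character -/

section Values

variable {n : ℕ} [hn : NeZero n] (χ : DirichletCharacter ℚ_[7] n) (v : ℕ → ℤ)

omit hn in
/-- A character with integer values `v` vanishes at the non-units: `v(a) = 0` for `a` not coprime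
to the level. [cite: Washington1997, Ch. 3 (Dirichlet characters)] -/
theorem quadVal_eq_zero (hχ : ∀ a : ℕ, χ (a : ZMod n) = ((v a : ℤ) : ℚ_[7])) {a : ℕ}
    (ha : ¬ a.Coprime n) : ((v a : ℤ) : ℚ_[7]) = 0 := by
  rw [← hχ]
  exact MulChar.map_nonunit χ (by rwa [ZMod.isUnit_iff_coprime])

omit hn in
/-- A character with values `v(a) ∈ {0, 1, −1}` has `v(a)² = 1` at the units (a character does not
vanish at a unit). [cite: Washington1997, Ch. 3 (Dirichlet characters)] -/
theorem quadVal_sq_eq_one (hχ : ∀ a : ℕ, χ (a : ZMod n) = ((v a : ℤ) : ℚ_[7]))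
    (hv : ∀ a : ℕ, v a = 0 ∨ v a = 1 ∨ v a = -1) {a : ℕ} (ha : a.Coprime n) :
    ((v a : ℤ) : ℚ_[7]) ^ 2 = 1 := by
  have hu : IsUnit (χ (a : ZMod n)) := ((ZMod.isUnit_iff_coprime a n).mpr ha).map χ
  rw [hχ] at hu
  rcases hv a with h | h | h
  · rw [h, Int.cast_zero] at hu; exact absurd hu not_isUnit_zero
  · rw [h]; norm_num
  · rw [h]; norm_num

omit hn in
/-- `(ℓ mod 7n)` read mod `7` is `ℓ` mod `7`. [folklore] -/
theorem natCast_val_zmod_seven_mul_level (ℓ : ℕ) :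
    ((((ℓ : ZMod (7 * n))).val : ℕ) : ZMod 7) = (ℓ : ZMod 7) := by
  rw [ZMod.val_natCast, ZMod.natCast_eq_natCast_iff]
  exact (Nat.mod_modEq ℓ (7 * n)).of_dvd (dvd_mul_right 7 n)

omit hn in
/-- The values are read through `ZMod (7n)`: `v((ℓ mod 7n)) = v(ℓ)` in `ℚ₇` (both are `χ(ℓ)`).
[folklore] -/
theorem quadVal_val_zmod (hχ : ∀ a : ℕ, χ (a : ZMod n) = ((v a : ℤ) : ℚ_[7])) (ℓ : ℕ) :
    ((v ((ℓ : ZMod (7 * n))).val : ℤ) : ℚ_[7]) = ((v ℓ : ℤ) : ℚ_[7]) := by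
  rw [← hχ, ← hχ, ZMod.val_natCast]
  congr 1
  rw [ZMod.natCast_eq_natCast_iff]
  exact (Nat.mod_modEq ℓ (7 * n)).of_dvd (dvd_mul_left n 7)

end Values

/-! ## §2 `ψ = χ↑·(ω²)↑` at level `7n` -/

section Psi

variable {n : ℕ} [hn : NeZero n] (ω : DirichletCharacter ℚ_[7] 7) (χ : DirichletCharacter ℚ_[7] n)
  (v : ℕ → ℤ)

/-- **Values of `ψ = χ↑·(ω²)↑` at level `7n`: `ψ(j) = v(j)·ω(j)²`** (units: `changeLevel`;
non-units: both sides vanish). [cite: KrizLi2019, §2 (p. 11, conventions on characters)] -/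
theorem psiK_apply (hχ : ∀ a : ℕ, χ (a : ZMod n) = ((v a : ℤ) : ℚ_[7])) (j : ZMod (7 * n)) :
    (changeLevel (dvd_mul_left n 7) χ * changeLevel (dvd_mul_right 7 n) (ω ^ 2) :
      DirichletCharacter ℚ_[7] (7 * n)) j =
      ((v j.val : ℤ) : ℚ_[7]) * ω (j.val : ZMod 7) ^ 2 := by
  have hj : ((j.val : ℤ) : ZMod (7 * n)) = j := by rw [Int.cast_natCast, ZMod.natCast_zmod_val]
  by_cases hu : IsCoprime (j.val : ℤ) ((7 * n : ℕ) : ℤ)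
  · conv_lhs => rw [← hj]
    rw [MulChar.mul_apply, changeLevel_eq_cast_of_dvd' _ _ hu, changeLevel_eq_cast_of_dvd' _ _ hu,
      MulChar.pow_apply' _ two_ne_zero, Int.cast_natCast, Int.cast_natCast, hχ]
  · have hnu : ¬ IsUnit j := by
      rw [← hj, ZMod.coe_int_isUnit_iff_isCoprime]; exact fun h => hu (by simpa [isCoprime_comm] using h)
    rw [MulChar.map_nonunit _ hnu]
    have h77 : ¬ (j.val).Coprime (7 * n) := fun h => hu (Nat.isCoprime_iff_coprime.mpr h)
    rw [Nat.coprime_mul_iff_right, not_and_or] at h77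
    rcases h77 with h7 | hmm
    · have hd : 7 ∣ j.val := by
        rwa [Nat.coprime_comm, Nat.Prime.coprime_iff_not_dvd (by norm_num), not_not] at h7
      have h0 : (j.val : ZMod 7) = 0 := (ZMod.natCast_eq_zero_iff _ _).mpr hd
      rw [h0, MulChar.map_zero, zero_pow two_ne_zero, mul_zero]
    · rw [quadVal_eq_zero χ v hχ hmm, zero_mul]

omit hn in
/-- **`ψ` is odd when `χ` is odd**: `ψ(−1) = χ(−1)·ω(−1)² = −1`.
[cite: KrizLi2019, §1.5 (p. 7, ψ₀ = ψε_K for ψ odd)] -/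
theorem psiK_odd (hχo : χ.Odd) :
    (changeLevel (dvd_mul_left n 7) χ * changeLevel (dvd_mul_right 7 n) (ω ^ 2) :
      DirichletCharacter ℚ_[7] (7 * n)).Odd := by
  have hc : IsCoprime (-1 : ℤ) ((7 * n : ℕ) : ℤ) := isCoprime_one_left.neg_left
  have h1 := changeLevel_eq_cast_of_dvd' χ (dvd_mul_left n 7) hc
  have h2 := changeLevel_eq_cast_of_dvd' (ω ^ 2) (dvd_mul_right 7 n) hc
  push_cast at h1 h2
  rw [DirichletCharacter.Odd, MulChar.mul_apply, h1, h2, hχo, MulChar.pow_apply' _ two_ne_zero, sq,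
    ← map_mul, neg_mul_neg, one_mul, map_one, mul_one]

/-- **The `hss` value identity: `ψ(ℓ) + ψ⁻¹(ℓ)ω(ℓ) = v(ℓ)·(ω(ℓ)² + ω(ℓ)⁵)` for `ℓ` coprime to
`7n`** — the hypothesis `hψ` of `RouteUTraceForm.hss_of_traceForm`.
[cite: KrizLi2019, Thm. 1.20 and §2 (trace form a_ℓ ≡ ψ(ℓ) + ψ⁻¹ω(ℓ))] -/
theorem psiK_traceIdentity (hχ : ∀ a : ℕ, χ (a : ZMod n) = ((v a : ℤ) : ℚ_[7]))
    (hv : ∀ a : ℕ, v a = 0 ∨ v a = 1 ∨ v a = -1) (ℓ : ℕ) (h7 : ¬ 7 ∣ ℓ) (hℓ : ℓ.Coprime n) :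
    (changeLevel (dvd_mul_left n 7) χ * changeLevel (dvd_mul_right 7 n) (ω ^ 2) :
        DirichletCharacter ℚ_[7] (7 * n)) (ℓ : ZMod (7 * n)) +
      (changeLevel (dvd_mul_left n 7) χ * changeLevel (dvd_mul_right 7 n) (ω ^ 2) :
        DirichletCharacter ℚ_[7] (7 * n))⁻¹ (ℓ : ZMod (7 * n)) * ω (ℓ : ZMod 7) =
      ((v ℓ : ℤ) : ℚ_[7]) * (ω (ℓ : ZMod 7) ^ 2 + ω (ℓ : ZMod 7) ^ 5) := by
  set ψ : DirichletCharacter ℚ_[7] (7 * n) :=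
    changeLevel (dvd_mul_left n 7) χ * changeLevel (dvd_mul_right 7 n) (ω ^ 2) with hψdef
  have hψℓ : ψ (ℓ : ZMod (7 * n)) = ((v ℓ : ℤ) : ℚ_[7]) * ω (ℓ : ZMod 7) ^ 2 := by
    rw [hψdef, psiK_apply ω χ v hχ, natCast_val_zmod_seven_mul_level, quadVal_val_zmod χ v hχ]
  have hL2 : ((v ℓ : ℤ) : ℚ_[7]) ^ 2 = 1 := quadVal_sq_eq_one χ v hχ hv hℓ
  have hω6 : ω (ℓ : ZMod 7) ^ 6 = 1 := by
    have := apply_pow_sub_one_eq_one ω (ℓ : ℤ) (by exact_mod_cast h7)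
    rwa [Int.cast_natCast] at this
  have hinv : ψ⁻¹ (ℓ : ZMod (7 * n)) = ((v ℓ : ℤ) : ℚ_[7]) * ω (ℓ : ZMod 7) ^ 4 := by
    rw [MulChar.inv_apply_eq_inv', hψℓ]
    apply inv_eq_of_mul_eq_one_right
    linear_combination (ω (ℓ : ZMod 7) ^ 6) * hL2 + hω6
  rw [hψℓ, hinv]
  ring

/-- **Values of `ψ⁻¹`: `ψ⁻¹(j) = v(j)·ω(j)⁴`** (the value hypothesis of the `θ₁`-certificate).
[cite: KrizLi2019, Thm. 1.20 (p. 8)] -/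
theorem psiK_inv_apply (hχ : ∀ a : ℕ, χ (a : ZMod n) = ((v a : ℤ) : ℚ_[7]))
    (hv : ∀ a : ℕ, v a = 0 ∨ v a = 1 ∨ v a = -1) (j : ZMod (7 * n)) :
    (changeLevel (dvd_mul_left n 7) χ * changeLevel (dvd_mul_right 7 n) (ω ^ 2) :
        DirichletCharacter ℚ_[7] (7 * n))⁻¹ j =
      ((v j.val : ℤ) : ℚ_[7]) * ω (j.val : ZMod 7) ^ 4 := by
  rw [MulChar.inv_apply_eq_inv', psiK_apply ω χ v hχ]
  by_cases h7 : 7 ∣ j.val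
  · have h0 : (j.val : ZMod 7) = 0 := (ZMod.natCast_eq_zero_iff _ _).mpr h7
    rw [h0, MulChar.map_zero, zero_pow two_ne_zero, zero_pow (by norm_num), mul_zero, inv_zero]
  by_cases hmj : (j.val).Coprime n
  · have hL2 : ((v j.val : ℤ) : ℚ_[7]) ^ 2 = 1 := quadVal_sq_eq_one χ v hχ hv hmj
    have hω6 : ω (j.val : ZMod 7) ^ 6 = 1 := by
      have := apply_pow_sub_one_eq_one ω (j.val : ℤ) (by exact_mod_cast h7)
      rwa [Int.cast_natCast] at this
    apply inv_eq_of_mul_eq_one_right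
    linear_combination (ω (j.val : ZMod 7) ^ 6) * hL2 + hω6
  · rw [quadVal_eq_zero χ v hχ hmj, zero_mul, zero_mul, inv_zero]

/-- **Values of `θ₁ = χ↑·(ω⁴)↑` at level `7n`: `θ₁(j) = v(j)·ω(j)⁴`** (it IS `ψ⁻¹`).
[cite: KrizLi2019, Thm. 1.20 (p. 8)] -/
theorem thetaOneK_apply (hχ : ∀ a : ℕ, χ (a : ZMod n) = ((v a : ℤ) : ℚ_[7])) (j : ZMod (7 * n)) :
    (changeLevel (dvd_mul_left n 7) χ * changeLevel (dvd_mul_right 7 n) (ω ^ 4) :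
      DirichletCharacter ℚ_[7] (7 * n)) j =
      ((v j.val : ℤ) : ℚ_[7]) * ω (j.val : ZMod 7) ^ 4 := by
  have hj : ((j.val : ℤ) : ZMod (7 * n)) = j := by rw [Int.cast_natCast, ZMod.natCast_zmod_val]
  by_cases hu : IsCoprime (j.val : ℤ) ((7 * n : ℕ) : ℤ)
  · conv_lhs => rw [← hj]
    rw [MulChar.mul_apply, changeLevel_eq_cast_of_dvd' _ _ hu, changeLevel_eq_cast_of_dvd' _ _ hu,
      MulChar.pow_apply' _ (by norm_num), Int.cast_natCast, Int.cast_natCast, hχ]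
  · have hnu : ¬ IsUnit j := by
      rw [← hj, ZMod.coe_int_isUnit_iff_isCoprime]; exact fun h => hu (by simpa [isCoprime_comm] using h)
    rw [MulChar.map_nonunit _ hnu]
    have h77 : ¬ (j.val).Coprime (7 * n) := fun h => hu (Nat.isCoprime_iff_coprime.mpr h)
    rw [Nat.coprime_mul_iff_right, not_and_or] at h77
    rcases h77 with h7 | hmm
    · have hd : 7 ∣ j.val := by
        rwa [Nat.coprime_comm, Nat.Prime.coprime_iff_not_dvd (by norm_num), not_not] at h7
      have h0 : (j.val : ZMod 7) = 0 := (ZMod.natCast_eq_zero_iff _ _).mpr hd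
      rw [h0, MulChar.map_zero, zero_pow (by norm_num), mul_zero]
    · rw [quadVal_eq_zero χ v hχ hmm, zero_mul]

/-- `θ₁ = ψ⁻¹` as characters of level `7n`. [cite: KrizLi2019, Thm. 1.20 (p. 8)] -/
theorem thetaOneK_eq_psiK_inv (hχ : ∀ a : ℕ, χ (a : ZMod n) = ((v a : ℤ) : ℚ_[7]))
    (hv : ∀ a : ℕ, v a = 0 ∨ v a = 1 ∨ v a = -1) :
    (changeLevel (dvd_mul_left n 7) χ * changeLevel (dvd_mul_right 7 n) (ω ^ 4) :
      DirichletCharacter ℚ_[7] (7 * n)) =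
      (changeLevel (dvd_mul_left n 7) χ * changeLevel (dvd_mul_right 7 n) (ω ^ 2))⁻¹ :=
  MulChar.ext' fun j => by rw [thetaOneK_apply ω χ v hχ, psiK_inv_apply ω χ v hχ hv]

/-! ## §3 The two Bernoulli characters of Thm. 1.20 at level `7n·r` -/

variable {r : ℕ} [hr : NeZero r] (κ : DirichletCharacter ℚ_[7] r) (w : ℕ → ℤ)

omit hn hr in
/-- **`bernoulliCharOne ψ κ = (ψ⁻¹)↑`** at level `7n·r` for `χ` odd (`ψ` odd, so `ψ₀ = ψκ` and
`ψ₀⁻¹κ = ψ⁻¹`). [cite: KrizLi2019, Thm. 1.20 (p. 8) and §1.5 (ψ₀)] -/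
theorem bernoulliCharOne_psiK (hχo : χ.Odd) :
    bernoulliCharOne
        (changeLevel (dvd_mul_left n 7) χ * changeLevel (dvd_mul_right 7 n) (ω ^ 2)) κ =
      changeLevel (dvd_mul_right (7 * n) r)
        (changeLevel (dvd_mul_left n 7) χ * changeLevel (dvd_mul_right 7 n) (ω ^ 2))⁻¹ := by
  have hodd := psiK_odd ω χ hχo
  have key : ∀ a b : DirichletCharacter ℚ_[7] (7 * n * r), (a * b)⁻¹ * b = a⁻¹ := fun a b => by
    rw [mul_inv_rev, mul_comm b⁻¹ a⁻¹, inv_mul_cancel_right]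
  rw [bernoulliCharOne, evenTwist, if_neg (hodd.not_even), key, map_inv]

omit hn hr in
/-- **`bernoulliCharTwo ψ κ ω = θ₂↑`** with `θ₂ := χ↑·κ↑·ω↑` at level `7n·r`, for `χ` odd.
[cite: KrizLi2019, Thm. 1.20 (p. 8) and §1.5] -/
theorem bernoulliCharTwo_psiK (hχo : χ.Odd) :
    bernoulliCharTwo
        (changeLevel (dvd_mul_left n 7) χ * changeLevel (dvd_mul_right 7 n) (ω ^ 2)) κ ω =
      changeLevel (dvd_mul_right (7 * n * r) 7)
        (changeLevel ((dvd_mul_left n 7).trans (dvd_mul_right (7 * n) r)) χ *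
          changeLevel (dvd_mul_left r (7 * n)) κ *
          changeLevel ((dvd_mul_right 7 n).trans (dvd_mul_right (7 * n) r)) ω) := by
  have hodd := psiK_odd ω χ hχo
  rw [bernoulliCharTwo, evenTwist, if_neg (hodd.not_even)]
  simp only [map_mul, map_pow, map_inv, ← changeLevel_trans]
  rw [mul_inv_eq_iff_eq_mul, sq]
  ext a
  simp only [MulChar.mul_apply]
  ring

/-- **Values of `θ₂ = χ↑·κ↑·ω↑` at level `7n·r`: `θ₂(j) = v(j)·w(j)·ω(j)`** when `κ` has the
integer values `w`. [cite: KrizLi2019, Thm. 1.20 (p. 8)] -/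
theorem thetaTwoK_apply (hχ : ∀ a : ℕ, χ (a : ZMod n) = ((v a : ℤ) : ℚ_[7]))
    (hκ : ∀ a : ℕ, κ (a : ZMod r) = ((w a : ℤ) : ℚ_[7])) (j : ZMod (7 * n * r)) :
    (changeLevel ((dvd_mul_left n 7).trans (dvd_mul_right (7 * n) r)) χ *
        changeLevel (dvd_mul_left r (7 * n)) κ *
        changeLevel ((dvd_mul_right 7 n).trans (dvd_mul_right (7 * n) r)) ω :
        DirichletCharacter ℚ_[7] (7 * n * r)) j =
      ((v j.val * w j.val : ℤ) : ℚ_[7]) * ω (j.val : ZMod 7) ^ 1 := by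
  have hj : ((j.val : ℤ) : ZMod (7 * n * r)) = j := by rw [Int.cast_natCast, ZMod.natCast_zmod_val]
  by_cases hu : IsCoprime (j.val : ℤ) ((7 * n * r : ℕ) : ℤ)
  · conv_lhs => rw [← hj]
    rw [MulChar.mul_apply, MulChar.mul_apply, changeLevel_eq_cast_of_dvd' _ _ hu,
      changeLevel_eq_cast_of_dvd' _ _ hu, changeLevel_eq_cast_of_dvd' _ _ hu, Int.cast_natCast,
      Int.cast_natCast, Int.cast_natCast, hχ, hκ, pow_one, Int.cast_mul]
  · have hnu : ¬ IsUnit j := by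
      rw [← hj, ZMod.coe_int_isUnit_iff_isCoprime]; exact fun h => hu (by simpa [isCoprime_comm] using h)
    rw [MulChar.map_nonunit _ hnu]
    have h3 : ¬ (j.val).Coprime (7 * n * r) := fun h => hu (Nat.isCoprime_iff_coprime.mpr h)
    rw [Nat.coprime_mul_iff_right, Nat.coprime_mul_iff_right, not_and_or, not_and_or] at h3
    rcases h3 with (h7 | hmm) | hrr
    · have hd : 7 ∣ j.val := by
        rwa [Nat.coprime_comm, Nat.Prime.coprime_iff_not_dvd (by norm_num), not_not] at h7
      rw [(ZMod.natCast_eq_zero_iff _ _).mpr hd, MulChar.map_zero, pow_one, mul_zero]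
    · rw [Int.cast_mul, quadVal_eq_zero χ v hχ hmm, zero_mul, zero_mul]
    · rw [Int.cast_mul, quadVal_eq_zero κ w hκ hrr, mul_zero, zero_mul]

end Psi

end Summit.BirchSwinnertonDyer.Rank1Residual.X12.O11.RouteU

end
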